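import Mathlib
import Summits.Ventures.PercRepro.TriangleCapDeepWitness
import Summits.Ventures.PercRepro.TriangleCapBandTwoComplete

/-!
# PercRepro — THE COMPLETE BAND ON `n` VERTICES, EVERY `ℓ`: THE SUB-BAND INTERVALS BELOW THE FIRST OVERLAP, ONE
INTERVAL FROM THERE TO THE EXTREMAL VALUE (p3, gen 53; part 269)

`twoW ℓ u = u (u + 1) − coll u (lfRR (ℓ − 1) 0) + 2 (ℓ − 1 − u)` is twice the width of the sub-band `u` (the sharp
bound of part 257: `twoW_eq_subQ` converts it to the tangent form `2 q u ≤ u (u + 1) + (ℓ − 1) q (q + 1)` at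
`q = subQ ℓ u`).  Every value of `[B(u), B(u) + W(u, ℓ)]`, `B(u) = u (t − u − 1)`, is attained for `2 u ≤ t`,
`ℓ + u ≤ t + 1` (`subband_attained`, the two interval theorems of part 263 in one statement), and `twoW` is
non-decreasing (`twoW_succ_ge`, by `coll_succ_le`), so once two consecutive sub-bands overlap
(`2 B(u₁ + 1) ≤ 2 B(u₁) + twoW ℓ u₁ + 2`) all the following ones do (`overlap_step`).  The chain lemma of part 268
then covers `[B(u₁), top(⌊t/2⌋)]` (`band_shallow_chain`), the deep chain covers `[top(⌊t/2⌋), jmax]`: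

**THE BAND IS ONE INTERVAL FROM `B(u₁)` TO ITS EXTREMAL VALUE** (`band_deep_complete`), and with the structure
theorems of parts 260 / 266 below `B(u₁)`:

**THE COMPLETE BAND** (`band_complete`): for `2 ≤ ℓ ≤ t`, `2 t ≤ s`, `1 ≤ u₁`, `2 u₁ ≤ t`, `ℓ + u₁ ≤ t`,
`ℓ + ⌊t/2⌋ ≤ t + 1`, the overlap at `u₁` and `4 (u₁ − 1) + 3 ≤ t ∨ ℓ u₁ < t`: the band value `2 j` is attained on
`ℓ + 1 + (s − t)` vertices IFF either `j < B(u₁)` and `j` lies in a sub-band interval `u < u₁`, or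
`B(u₁) ≤ j` and `2 j + 2 q t ≤ t (t − 1) + ℓ q (q + 1)`, `q = ⌊t/ℓ⌋` — the census of part 252 (every `2 ≤ ℓ ≤ 5`,
`ℓ ≤ t ≤ 22`) verbatim.  Axioms: standard.
-/

namespace PercRepro

namespace TriangleCap

namespace C047

open Finset

/-- Twice the width of the sub-band `u` with `ℓ` non-neighbours:
`u (u + 1) − coll u (lfRR (ℓ − 1) 0) + 2 (ℓ − 1 − u)`. -/
def twoW (ℓ u : ℕ) : ℕ := u * (u + 1) - coll u (lfRR (ℓ - 1) 0) + 2 * (ℓ - 1 - u)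

/-- The width is non-decreasing: `twoW ℓ u ≤ twoW ℓ (u + 1)`. -/
theorem twoW_succ_ge (ℓ u : ℕ) : twoW ℓ u ≤ twoW ℓ (u + 1) := by
  unfold twoW
  have hstep := coll_succ_le u (lfRR (ℓ - 1) 0)
  have hc1 := coll_le u (lfRR (ℓ - 1) 0)
  have hc2 := coll_le (u + 1) (lfRR (ℓ - 1) 0)
  have hu1 : u * (u - 1) ≤ u * (u + 1) := Nat.mul_le_mul_left u (by omega)
  have hu2 : (u + 1) * (u + 1 - 1) ≤ (u + 1) * (u + 1 + 1) := Nat.mul_le_mul_left _ (by omega)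
  have e3 : (u + 1) * (u + 1 + 1) = u * (u + 1) + 2 * (u + 1) := by ring
  omega

/-- `twoW` dominates the `(ℓ − 1)`-carrier top: `deepTop t (ℓ − 1) u ≤ 2 u (t − u − 1) + twoW ℓ u`. -/
theorem deepTop_le_twoW (ℓ t u : ℕ) : deepTop t (ℓ - 1) u ≤ 2 * (u * (t - u - 1)) + twoW ℓ u := by
  unfold deepTop twoW
  omega

/-- **THE TANGENT FORM OF THE WIDTH:** for `2 ≤ ℓ`, `1 ≤ u` and `q = subQ ℓ u = max 1 ⌊u / (ℓ − 1)⌋`,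
`twoW ℓ u + 2 q u = u (u + 1) + (ℓ − 1) q (q + 1)`. -/
theorem twoW_eq_subQ (ℓ u : ℕ) (hℓ : 2 ≤ ℓ) (hu : 1 ≤ u) :
    twoW ℓ u + 2 * (subQ ℓ u * u) = u * (u + 1) + (ℓ - 1) * (subQ ℓ u * (subQ ℓ u + 1)) := by
  unfold twoW subQ
  have hk : 0 < ℓ - 1 := by omega
  rcases Nat.lt_or_ge u (ℓ - 1) with hsmall | hbig
  · -- `u < ℓ − 1`: no collision, `q = 1`
    rw [coll_lfRR_zero (ℓ - 1) u hk, Nat.div_eq_of_lt hsmall, max_eq_left (Nat.zero_le 1)]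
    simp only [Nat.zero_sub, mul_zero, add_zero, Nat.sub_zero]
    have e : u * (u + 1) = u * (u - 1) + 2 * u := by
      obtain ⟨u', rfl⟩ : ∃ u', u = u' + 1 := ⟨u - 1, by omega⟩
      rw [Nat.add_sub_cancel]
      ring
    omega
  · -- `u ≥ ℓ − 1`: the balanced round-robin, `q = ⌊u / (ℓ − 1)⌋ ≥ 1`
    have hq : 1 ≤ u / (ℓ - 1) := Nat.div_pos hbig hk
    rw [max_eq_right hq]
    have hth := row_threshold (ℓ - 1) u
    have hle : coll u (lfRR (ℓ - 1) 0) ≤ u * (u - 1) := coll_le u _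
    rw [coll_lfRR_zero (ℓ - 1) u hk] at hle ⊢
    have hu1 : u * (u - 1) ≤ u * (u + 1) := Nat.mul_le_mul_left u (by omega)
    have e : ℓ - 1 - u = 0 := by omega
    rw [e, mul_zero, add_zero, mul_assoc] at *
    omega

/-- **EVERY SUB-BAND INTERVAL IS ATTAINED:** for `2 ≤ ℓ`, `1 ≤ u`, `2 u ≤ t`, `ℓ + u ≤ t + 1`, `2 t ≤ s`, every `j`
with `u (t − u − 1) ≤ j` and `2 j ≤ 2 u (t − u − 1) + twoW ℓ u` is attained on `ℓ + 1 + (s − t)` vertices. -/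
theorem subband_attained (ℓ s t u j : ℕ) (hℓ : 2 ≤ ℓ) (hu : 1 ≤ u) (hut : 2 * u ≤ t) (hℓt : ℓ + u ≤ t + 1)
    (hs : 2 * t ≤ s) (hj1 : u * (t - u - 1) ≤ j) (hj2 : 2 * j ≤ 2 * (u * (t - u - 1)) + twoW ℓ u) :
    ∃ (H : SimpleGraph (Fin (ℓ + 1 + (s - t)))) (_ : DecidableRel H.Adj), H.CliqueFree 3 ∧
      H.edgeFinset.card = s ∧ (∃ w, deg H w + t = s) ∧
      ∑ v, deg H v * deg H v + 2 * (t * (s - t - 1)) + 2 * j = s * (s + 1) := by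
  unfold twoW at hj2
  by_cases hcase : u ≤ ℓ - 1
  · -- `u` carriers: the small interval theorem's family
    apply subband_interval ℓ s t u u j hu (by omega) hu hut (by omega) hs hj1
    rw [coll_lfRR_zero u u hu, Nat.div_self hu, Nat.mod_self]
    simp only [Nat.sub_self, mul_zero, zero_mul, add_zero, Nat.sub_zero]
    have hc := coll_le u (lfRR (ℓ - 1) 0)
    have hu1 : u * (u - 1) ≤ u * (u + 1) := Nat.mul_le_mul_left u (by omega)
    omega
  · -- `ℓ − 1` carriers
    apply subband_interval ℓ s t u (ℓ - 1) j (by omega) (by omega) hu hut (by omega) hs hj1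
    have e : ℓ - 1 - (ℓ - 1) = 0 := Nat.sub_self _
    have e' : ℓ - 1 - u = 0 := by omega
    rw [e]
    rw [e'] at hj2
    omega

/-- **THE OVERLAP PROPAGATES:** if the sub-band `u + 1` starts at most one above the top of the sub-band `u`, so does
`u + 2` above `u + 1` (the bottoms step down by `2` per step, the widths never decrease). -/
theorem overlap_step (ℓ t u : ℕ)
    (h : 2 * ((u + 1) * (t - u - 2)) ≤ 2 * (u * (t - u - 1)) + twoW ℓ u + 2) :
    2 * ((u + 2) * (t - u - 3)) ≤ 2 * ((u + 1) * (t - u - 2)) + twoW ℓ (u + 1) + 2 := by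
  have hmono := twoW_succ_ge ℓ u
  rcases Nat.lt_or_ge t (u + 4) with hlt | hge
  · have e : t - u - 3 = 0 := by omega
    rw [e, mul_zero, mul_zero]
    exact Nat.zero_le _
  · obtain ⟨d, rfl⟩ : ∃ d, t = u + 4 + d := ⟨t - u - 4, by omega⟩
    have e1 : u + 4 + d - u - 3 = d + 1 := by omega
    have e2 : u + 4 + d - u - 2 = d + 2 := by omega
    have e3 : u + 4 + d - u - 1 = d + 3 := by omega
    rw [e2, e3] at h
    rw [e1, e2]
    have f1 : (u + 2) * (d + 1) = u * d + u + 2 * d + 2 := by ring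
    have f2 : (u + 1) * (d + 2) = u * d + 2 * u + d + 2 := by ring
    have f3 : u * (d + 3) = u * d + 3 * u := by ring
    rw [f1, f2]
    rw [f2, f3] at h
    omega

/-- The overlap at `u₁` gives the overlap at every `u ≥ u₁`. -/
theorem overlap_of_le (ℓ t u₁ : ℕ)
    (h : 2 * ((u₁ + 1) * (t - u₁ - 2)) ≤ 2 * (u₁ * (t - u₁ - 1)) + twoW ℓ u₁ + 2) :
    ∀ u, u₁ ≤ u → 2 * ((u + 1) * (t - u - 2)) ≤ 2 * (u * (t - u - 1)) + twoW ℓ u + 2 := by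
  intro u hu
  induction u with
  | zero =>
    have : u₁ = 0 := by omega
    subst this
    exact h
  | succ u ih =>
    rcases Nat.eq_or_lt_of_le hu with heq | hlt
    · subst heq
      exact h
    · have := overlap_step ℓ t u (ih (by omega))
      have e1 : t - (u + 1) - 2 = t - u - 3 := by omega
      have e2 : t - (u + 1) - 1 = t - u - 2 := by omega
      rw [e1, e2]
      exact this

/-- **THE SHALLOW CHAIN:** for `2 ≤ ℓ`, `1 ≤ u₁ ≤ u₂`, `2 u₂ ≤ t`, `ℓ + u₂ ≤ t + 1`, `2 t ≤ s` and the overlap at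
`u₁`, every `j` from `B(u₁)` to the top `B(u₂) + W(u₂, ℓ)` of the sub-band `u₂` is attained on `ℓ + 1 + (s − t)`
vertices. -/
theorem band_shallow_chain (ℓ s t u₁ u₂ : ℕ) (hℓ : 2 ≤ ℓ) (hu : 1 ≤ u₁) (hu12 : u₁ ≤ u₂) (hut : 2 * u₂ ≤ t)
    (hℓt : ℓ + u₂ ≤ t + 1) (hs : 2 * t ≤ s)
    (hov : 2 * ((u₁ + 1) * (t - u₁ - 2)) ≤ 2 * (u₁ * (t - u₁ - 1)) + twoW ℓ u₁ + 2) :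
    ∀ j, u₁ * (t - u₁ - 1) ≤ j → 2 * j ≤ 2 * (u₂ * (t - u₂ - 1)) + twoW ℓ u₂ →
      ∃ (H : SimpleGraph (Fin (ℓ + 1 + (s - t)))) (_ : DecidableRel H.Adj), H.CliqueFree 3 ∧
        H.edgeFinset.card = s ∧ (∃ w, deg H w + t = s) ∧
        ∑ v, deg H v * deg H v + 2 * (t * (s - t - 1)) + 2 * j = s * (s + 1) := by
  intro j hj1 hj2
  have hchain := chain_attained (fun j => ∃ (H : SimpleGraph (Fin (ℓ + 1 + (s - t)))) (_ : DecidableRel H.Adj),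
      H.CliqueFree 3 ∧ H.edgeFinset.card = s ∧ (∃ w, deg H w + t = s) ∧
      ∑ v, deg H v * deg H v + 2 * (t * (s - t - 1)) + 2 * j = s * (s + 1))
    (fun u => u * (t - u - 1)) (fun u => (2 * (u * (t - u - 1)) + twoW ℓ u) / 2) u₁ u₂ hu12 ?_ ?_ j hj1 ?_
  · exact hchain
  · intro u hu1 hu2 j hj1 hj2
    exact subband_attained ℓ s t u j hℓ (by omega) (by omega) (by omega) hs hj1 (by omega)
  · intro u hu1 hu2
    have := overlap_of_le ℓ t u₁ hov u hu1
    have e : t - (u + 1) - 1 = t - u - 2 := by omega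
    rw [e]
    omega
  · omega

/-- **THE BAND IS ONE INTERVAL FROM `B(u₁)` TO ITS EXTREMAL VALUE:** for `2 ≤ ℓ ≤ t`, `1 ≤ u₁`, `2 u₁ ≤ t`,
`ℓ + ⌊t/2⌋ ≤ t + 1`, `2 t ≤ s` and the overlap at `u₁`, every `j` with `u₁ (t − u₁ − 1) ≤ j` and
`2 j + 2 (t / ℓ) t ≤ t (t − 1) + ℓ (t / ℓ)(t / ℓ + 1)` is attained on `ℓ + 1 + (s − t)` vertices. -/
theorem band_deep_complete (ℓ s t u₁ : ℕ) (hℓ : 2 ≤ ℓ) (hℓt : ℓ ≤ t) (hu : 1 ≤ u₁) (hut : 2 * u₁ ≤ t)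
    (hℓt2 : ℓ + t / 2 ≤ t + 1) (hs : 2 * t ≤ s)
    (hov : 2 * ((u₁ + 1) * (t - u₁ - 2)) ≤ 2 * (u₁ * (t - u₁ - 1)) + twoW ℓ u₁ + 2) :
    ∀ j, u₁ * (t - u₁ - 1) ≤ j → 2 * j + 2 * (t / ℓ) * t ≤ t * (t - 1) + ℓ * ((t / ℓ) * (t / ℓ + 1)) →
      ∃ (H : SimpleGraph (Fin (ℓ + 1 + (s - t)))) (_ : DecidableRel H.Adj), H.CliqueFree 3 ∧
        H.edgeFinset.card = s ∧ (∃ w, deg H w + t = s) ∧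
        ∑ v, deg H v * deg H v + 2 * (t * (s - t - 1)) + 2 * j = s * (s + 1) := by
  intro j hj1 hj2
  by_cases hcase : 2 * j ≤ 2 * ((t / 2) * (t - t / 2 - 1)) + twoW ℓ (t / 2)
  · exact band_shallow_chain ℓ s t u₁ (t / 2) hℓ hu (by omega) (by omega) hℓt2 hs hov j hj1 hcase
  · have := deepTop_le_twoW ℓ t (t / 2)
    exact band_above_half_attained ℓ s t hℓ hℓt hs j (by omega) hj2

/-- **THE COMPLETE BAND ON `n` VERTICES:** for `2 ≤ ℓ ≤ t`, `2 t ≤ s`, `1 ≤ u₁`, `2 u₁ ≤ t`, `ℓ + u₁ ≤ t`,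
`ℓ + ⌊t/2⌋ ≤ t + 1`, the overlap `2 B(u₁ + 1) ≤ 2 B(u₁) + twoW ℓ u₁ + 2` of the sub-bands `u₁` and `u₁ + 1`, and
`4 (u₁ − 1) + 3 ≤ t ∨ ℓ u₁ < t`: the band value `2 j` is attained on `ℓ + 1 + (s − t)` vertices IFF
either `j < B(u₁)` and `j` lies in a sub-band interval `u < u₁` (`B(u) ≤ j` and the tangent bound at `q = subQ ℓ u`),
or `B(u₁) ≤ j` and `2 j + 2 (t / ℓ) t ≤ t (t − 1) + ℓ (t / ℓ)(t / ℓ + 1)`. -/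
theorem band_complete (ℓ s t u₁ j : ℕ) (hℓ : 2 ≤ ℓ) (hℓt : ℓ ≤ t) (hs : 2 * t ≤ s) (hu : 1 ≤ u₁) (hut : 2 * u₁ ≤ t)
    (hℓu : ℓ + u₁ ≤ t) (hℓt2 : ℓ + t / 2 ≤ t + 1)
    (hov : 2 * ((u₁ + 1) * (t - u₁ - 2)) ≤ 2 * (u₁ * (t - u₁ - 1)) + twoW ℓ u₁ + 2)
    (hstruct : 4 * (u₁ - 1) + 3 ≤ t ∨ ℓ * u₁ < t) :
    (∃ (H : SimpleGraph (Fin (ℓ + 1 + (s - t)))) (_ : DecidableRel H.Adj), H.CliqueFree 3 ∧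
      H.edgeFinset.card = s ∧ (∃ w, deg H w + t = s) ∧
      ∑ v, deg H v * deg H v + 2 * (t * (s - t - 1)) + 2 * j = s * (s + 1)) ↔
    ((j < u₁ * (t - u₁ - 1) ∧ ∃ u, u + 1 ≤ u₁ ∧ u * (t - u - 1) ≤ j ∧
        2 * j + 2 * (subQ ℓ u * u) ≤ 2 * (u * (t - u - 1)) + u * (u + 1) + (ℓ - 1) * (subQ ℓ u * (subQ ℓ u + 1))) ∨
      (u₁ * (t - u₁ - 1) ≤ j ∧ 2 * j + 2 * (t / ℓ) * t ≤ t * (t - 1) + ℓ * ((t / ℓ) * (t / ℓ + 1)))) := by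
  -- the exact description below `B(u₁)`, at depth `u₀ = u₁ − 1`
  have hexact : j < u₁ * (t - u₁ - 1) →
      ((∃ (H : SimpleGraph (Fin (ℓ + 1 + (s - t)))) (_ : DecidableRel H.Adj), H.CliqueFree 3 ∧
        H.edgeFinset.card = s ∧ (∃ w, deg H w + t = s) ∧
        ∑ v, deg H v * deg H v + 2 * (t * (s - t - 1)) + 2 * j = s * (s + 1)) ↔
      ∃ u, u ≤ u₁ - 1 ∧ u * (t - u - 1) ≤ j ∧
        2 * j + 2 * (subQ ℓ u * u) ≤ 2 * (u * (t - u - 1)) + u * (u + 1) + (ℓ - 1) * (subQ ℓ u * (subQ ℓ u + 1))) := by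
    intro hj
    have e1 : u₁ - 1 + 1 = u₁ := by omega
    have e2 : t - (u₁ - 1) - 2 = t - u₁ - 1 := by omega
    rcases hstruct with h4 | hℓ1
    · have := band_exact ℓ s t (u₁ - 1) j hℓ h4 (by omega) hs (by rw [e1, e2]; exact hj)
      exact this
    · have := band_exact' ℓ s t (u₁ - 1) j hℓ (by rw [e1]; exact hℓ1) (by omega) hs (by rw [e1, e2]; exact hj)
      exact this
  constructor
  · intro hatt
    rcases Nat.lt_or_ge j (u₁ * (t - u₁ - 1)) with hj | hj
    · left
      obtain ⟨u, hu0, hlow, hup⟩ := (hexact hj).mp hatt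
      exact ⟨hj, u, by omega, hlow, hup⟩
    · right
      refine ⟨hj, ?_⟩
      obtain ⟨H, _, hfree, hs', ⟨w, hw⟩, hj'⟩ := hatt
      exact ((vertex_band_extremal ℓ s t (by omega) (by omega) hs).1 H hfree hs' w hw j hj').2.2 hℓt
  · rintro (⟨hj, u, hu0, hlow, hup⟩ | ⟨hj, hmax⟩)
    · exact (hexact hj).mpr ⟨u, by omega, hlow, hup⟩
    · exact band_deep_complete ℓ s t u₁ hℓ hℓt hu hut hℓt2 hs hov j hj hmax

end C047

end TriangleCap

end PercRepro
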